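import Mathlib.LinearAlgebra.Matrix.Determinant.Basic
import Mathlib.LinearAlgebra.Matrix.Notation
import Mathlib.Data.ZMod.Basic
import Mathlib.Analysis.SpecialFunctions.Pow.Real
import Mathlib.Tactic.Ring
import Mathlib.Tactic.Linarith
import HarnessLib

/-!
# Venture HSemireg — the real descent of a pair block: Gram determinant `m²` of the quaternary form `h_M` and the parity
# input of THEOREM 30-K (ENGINE-W PROBE5 §32, LEMMA 32.1 and THEOREM 30-K (i)) — kernel arithmetic

HONEST FRAMING. Lean index of the computation cell `pub-hsemireg`, widening group ENGINE-W (code A, seat `engine-w-1`,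
gen 16). INTEGER ARITHMETIC of one `4 × 4` Gram matrix; no abelian variety, sheaf, `Ext` group or semiregularity map is
constructed; nothing here says that HC, HC_CM or HC_AV holds. Theorems only (0 `def`, 0 named fact, 0 `sorry`). Companion of
`PairBlockEvenPolarisationObstruction.lean` (THEOREM 30-J's skeleton; same notation `Q`, `d`, `m`, `N′`).

SOURCE (the cell's own result): `widen/ENGINE-W/out/probe5/PROBE5-STIZ-A.md` §32 (v3.8; file of record v4.9k
`d984e355a7a98c81`), card `MNEG-PAIRBLOCK-CARD-A.md` v1.5 «THE REAL DESCENT». LEMMA 32.1: for a REAL polarisation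
`H₂ = [[a,b],[b,c]]` (`d = ac − b²`), an integral oriented target `(A, N)`, `N = N′d`, `tN = A² − m`, the descended lattice
`M = ℤ² + μH₂⁻¹ℤ²` carries the integral quaternary form `h_M[(u,y)] = t·H₂[u] + 2A·uᵀy + N′·adj(H₂)[y]` «with Gram matrix
`[[t·H₂, A·I],[A·I, (N∕d)·adj H₂]]` and determinant `(tN − A²)² = m²`» (hand ×2 across seats: red-w-2 g37; machine: `det = m²`
on 9 cells, v3.8). THEOREM 30-K (i) («`ℚ(√−2)`: a real primitive `H₂`-block is REACHED ⟺ `H₂` has an odd diagonal entry»), step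
(i) of the proof: «`M` is an ODD quaternary lattice: its Gram diagonal is `(ta, tc, (N∕d)c, (N∕d)a)`; `tN = A² + 2 ≢ 0 (mod 4)`,
so `t` and `N` are not both even; if `t` is odd, `ta` or `tc` is odd; if `t` is even, `N` — hence `N∕d` — is odd and `(N∕d)a`
or `(N∕d)c` is odd», and step (iii)'s unit input «`5 + 2√6 = N(√−2 + √−3)`» (THEOREM 30-F at `m = −2`). What the kernel holds:

* §1 **`gram_det`** — `det [[ta, tb, A, 0],[tb, tc, 0, A],[A, 0, N′c, −N′b],[0, A, −N′b, N′a]] = (tN′d − A²)² = m²` over any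
  commutative ring (cofactor expansion + `ring`); `gram_det_eq_four` ∕ `gram_det_eq_one`: `= 4` at `m = −2`, `= 1` at `m = −1`
  (the two inputs «`det(M) = m² = 4`», «at `ℚ(i)` … `det M = 1`» of 30-K (ii) and COROLLARY (b)).
* §2 `sq_add_two_not_dvd_four` — `4 ∤ A² + 2`; **`descent_odd`** (THEOREM 30-K (i)): `t·N′·d = A² + 2` and (`a` odd or `c` odd)
  ⟹ one of the Gram diagonal entries `ta, tc, N′c, N′a` is odd — `M` is an odd lattice.
* §3 `norm_sqrt_neg_two_add_sqrt_neg_three` — `(√2 + √3)² = 5 + 2√6` in `ℝ`, i.e. `|√−2 + √−3|² = 5 + 2√6`: the fundamental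
  totally positive unit of `ℚ(√6)` is a norm from `F = ℚ(√−2, √−3)` (30-F's unit hypothesis at `m = −2`, by value there).
WHAT IS NOT HERE: Korkine–Zolotarev `γ₄ = √2` ∕ `D₄` extremality (30-K (ii)), THEOREM 30-F itself, the model fact LEMMA 32.1.
-/

namespace Summit.Ventures.HSemireg.PairBlock

open Matrix

/-! ## §1 The Gram determinant of the descended quaternary form -/

/-- **LEMMA 32.1's determinant**: the Gram matrix `[[t·H₂, A·I],[A·I, N′·adj H₂]]` of `h_M` in the coordinates `(u₁, u₂, y₁, y₂)`
has determinant `(t·N′·d − A²)²`, `d = ac − b²` — i.e. `m²` with `m = A² − tN′d` («determinant `(tN − A²)² = m²`»). [kernel] -/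
theorem gram_det {R : Type*} [CommRing R] (a b c t A N' : R) :
    Matrix.det !![t * a, t * b, A, 0; t * b, t * c, 0, A; A, 0, N' * c, -(N' * b); 0, A, -(N' * b), N' * a]
      = (t * N' * (a * c - b ^ 2) - A ^ 2) ^ 2 := by
  rw [Matrix.det_succ_row_zero]
  simp [Fin.sum_univ_succ, Matrix.det_fin_three, Matrix.submatrix_apply, Fin.succAbove]
  ring

/-- At `m = −2` (`tN′d = A² + 2`, the node field `ℚ(√−2)`): `det(M) = 4` (input of 30-K (ii): «`det(M) = m² = 4`»). [kernel] -/
theorem gram_det_eq_four {R : Type*} [CommRing R] (a b c t A N' : R) (hm : t * N' * (a * c - b ^ 2) = A ^ 2 + 2) :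
    Matrix.det !![t * a, t * b, A, 0; t * b, t * c, 0, A; A, 0, N' * c, -(N' * b); 0, A, -(N' * b), N' * a] = 4 := by
  rw [gram_det, hm]
  ring

/-- At `m = −1` (`tN′d = A² + 1`, the node field `ℚ(i)`): `det(M) = 1` (COROLLARY (b) of 30-K: «at `ℚ(i)` … `det M = 1`»). [kernel] -/
theorem gram_det_eq_one {R : Type*} [CommRing R] (a b c t A N' : R) (hm : t * N' * (a * c - b ^ 2) = A ^ 2 + 1) :
    Matrix.det !![t * a, t * b, A, 0; t * b, t * c, 0, A; A, 0, N' * c, -(N' * b); 0, A, -(N' * b), N' * a] = 1 := by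
  rw [gram_det, hm]
  ring

/-! ## §2 THEOREM 30-K (i): at `ℚ(√−2)` the descended lattice of an `H₂` with an odd diagonal entry is odd -/

/-- `A² + 2` is never divisible by `4` (squares are `0, 1 (mod 4)`): «`tN = A² + 2 ≢ 0 (mod 4)`». [kernel] -/
theorem sq_add_two_not_dvd_four (A : ℤ) : ¬ (4 : ℤ) ∣ A ^ 2 + 2 := by
  intro h
  have h4 : ((A ^ 2 + 2 : ℤ) : ZMod 4) = 0 := (ZMod.intCast_zmod_eq_zero_iff_dvd _ 4).2 h
  push_cast at h4
  have key : ∀ z : ZMod 4, z ^ 2 + 2 ≠ 0 := by decide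
  exact key _ h4

/-- **THEOREM 30-K (i) — kernel form.** If `t·N′·d = A² + 2` (the node field `ℚ(√−2)`) and `H₂ = [[a,b],[b,c]]` has an odd
diagonal entry, then one of the diagonal Gram entries `ta, tc, N′c, N′a` of `h_M` is odd: `M` is an ODD lattice («if `t` is
odd, `ta` or `tc` is odd; if `t` is even, `N∕d` is odd and `(N∕d)a` or `(N∕d)c` is odd»). [kernel] -/
theorem descent_odd (a c t A N' d : ℤ) (hm : t * N' * d = A ^ 2 + 2) (hodd : Odd a ∨ Odd c) :
    Odd (t * a) ∨ Odd (t * c) ∨ Odd (N' * c) ∨ Odd (N' * a) := by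
  rcases Int.even_or_odd t with ht | ht
  · -- `t` even ⟹ `N′` odd (else `4 ∣ t·N′·d = A² + 2`)
    have hN : Odd N' := by
      rcases Int.even_or_odd N' with hN' | hN'
      · exfalso
        obtain ⟨t₁, rfl⟩ := ht
        obtain ⟨n₁, rfl⟩ := hN'
        apply sq_add_two_not_dvd_four A
        rw [← hm]
        exact ⟨t₁ * n₁ * d, by ring⟩
      · exact hN'
    rcases hodd with ha | hc
    · exact Or.inr (Or.inr (Or.inr (Int.odd_mul.2 ⟨hN, ha⟩)))
    · exact Or.inr (Or.inr (Or.inl (Int.odd_mul.2 ⟨hN, hc⟩)))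
  · rcases hodd with ha | hc
    · exact Or.inl (Int.odd_mul.2 ⟨ht, ha⟩)
    · exact Or.inr (Or.inl (Int.odd_mul.2 ⟨ht, hc⟩))

/-- The same with `d = ac − b²` substituted (the shape used in `PairBlockEvenPolarisationObstruction.lean`). [kernel] -/
theorem descent_odd' (a b c t A N' : ℤ) (hm : t * N' * (a * c - b ^ 2) = A ^ 2 + 2) (hodd : Odd a ∨ Odd c) :
    Odd (t * a) ∨ Odd (t * c) ∨ Odd (N' * c) ∨ Odd (N' * a) :=
  descent_odd a c t A N' (a * c - b ^ 2) hm hodd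

/-! ## §3 The unit input of THEOREM 30-F at `m = −2`: `5 + 2√6` is a norm from `ℚ(√−2, √−3)` -/

/-- `(√2 + √3)² = 5 + 2√6`: since `|√−2 + √−3|² = (√2 + √3)²`, the fundamental totally positive unit `5 + 2√6` of `ℚ(√6)` is
the norm `N_{F∕F⁺}(√−2 + √−3)` («`5 + 2√6 = N(√−2 + √−3)`», THEOREM 30-K (iii) ∕ 30-F). [kernel] -/
theorem norm_sqrt_neg_two_add_sqrt_neg_three :
    (Real.sqrt 2 + Real.sqrt 3) ^ 2 = 5 + 2 * Real.sqrt 6 := by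
  have h2 : Real.sqrt 2 ^ 2 = 2 := Real.sq_sqrt (by norm_num)
  have h3 : Real.sqrt 3 ^ 2 = 3 := Real.sq_sqrt (by norm_num)
  have h6 : Real.sqrt 6 = Real.sqrt 2 * Real.sqrt 3 := by
    rw [← Real.sqrt_mul (by norm_num : (0:ℝ) ≤ 2)]
    norm_num
  rw [h6]
  nlinarith [h2, h3]

end Summit.Ventures.HSemireg.PairBlock
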